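import Mathlib.Analysis.InnerProductSpace.Projection.FiniteDimensional
import HarnessLib

/-!
# The vertical velocity of a moving graph from its normal velocity (White 2005, §8.4, algebra)

Topic `Literature/Geometry/Riemannian`.  In the derivation of the nonparametric mean curvature flow
system (White 2005, Appendix §8.4, formula (11) on p. 1505:
`∂ₜu - Δu = f + π′β - Du ∘ πβ`), the forcing enters through the following piece of linear
algebra.  Let `V` be a real inner product space, `L ≤ V` a subspace with orthogonal complement
`Lᗮ` ("horizontal" `R^m` and "vertical" `R^{N-m}`), `D : L →ₗ Lᗮ` a linear map (the differential
`Du` of the graph function) and `T = {c + D c : c ∈ L}` the tangent space of the graph.  If a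
VERTICAL vector `w ∈ Lᗮ` (the vertical velocity `(0, ∂ₜu)`) has normal part
`β = w - P_T w` (the normal velocity minus the mean curvature, both normal to `T`), then

  `w = P_{Lᗮ} β - D (P_L β)`            (`vertical_eq_proj_sub_map_proj`),

i.e. `∂ₜu = π′β - Du(πβ)` with `π = P_L`, `π′ = P_{Lᗮ}`.  Conversely the tangential part of `w`
is `c + Dc` with `c = -P_L β` (`proj_tangent_eq`).  Membership in `T` ("elements of `T` are
`c + D c`") is Mathlib's `LinearMap.mem_range`, used directly.

Everything is PROVED; no definitions, no named facts.

## References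

* B. White, *A local regularity theorem for mean curvature flow*, Ann. of Math. 161 (2005),
  §8.4 and p. 1505 (11)–(12). [White2005]
-/

noncomputable section

namespace Literature.Geometry.Riemannian

open Submodule

variable {V : Type*} [NormedAddCommGroup V] [InnerProductSpace ℝ V]

/-- **White's velocity identity** (§8.4): for `w ∈ Lᗮ` vertical and `T` the graph of
`D : L → Lᗮ`, with `β = w - P_T w` the part of `w` normal to `T`:
`w = P_{Lᗮ} β - D (P_L β)`. [cite: White2005, §8.4 p. 1505 (11)] -/
theorem vertical_eq_proj_sub_map_proj (L : Submodule ℝ V) [L.HasOrthogonalProjection]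
    (D : L →ₗ[ℝ] Lᗮ)
    [(LinearMap.range (L.subtype + Lᗮ.subtype ∘ₗ D)).HasOrthogonalProjection]
    {w : V} (hw : w ∈ Lᗮ) :
    w = Lᗮ.starProjection (w - (LinearMap.range (L.subtype + Lᗮ.subtype ∘ₗ D)).starProjection w) -
      (D (L.orthogonalProjectionOnto
        (w - (LinearMap.range (L.subtype + Lᗮ.subtype ∘ₗ D)).starProjection w)) : V) := by
  set T := LinearMap.range (L.subtype + Lᗮ.subtype ∘ₗ D) with hT
  -- `P_T w = c + D c`
  obtain ⟨c, hc⟩ : ∃ c : L, (c : V) + (D c : V) = T.starProjection w :=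
    LinearMap.mem_range.1 (starProjection_apply_mem T w)
  set β := w - T.starProjection w with hβ
  have hβ' : β = w - (c : V) - (D c : V) := by rw [hβ, ← hc]; abel
  -- horizontal and vertical parts of `β = w - c - D c`
  have hcL : (c : V) ∈ L := c.2
  have hDc : (D c : V) ∈ Lᗮ := (D c).2
  have hPw : L.orthogonalProjectionOnto w = 0 := (orthogonalProjectionOnto_eq_zero_iff).2 hw
  have hPc : L.orthogonalProjectionOnto (c : V) = c :=
    orthogonalProjectionOnto_mem_subspace_eq_self c
  have hPDc : L.orthogonalProjectionOnto (D c : V) = 0 :=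
    (orthogonalProjectionOnto_eq_zero_iff).2 hDc
  have hQw : Lᗮ.starProjection w = w := (starProjection_eq_self_iff).2 hw
  have hQc : Lᗮ.starProjection (c : V) = 0 := by
    rw [starProjection_apply, (orthogonalProjectionOnto_eq_zero_iff).2
      (le_orthogonal_orthogonal L hcL), coe_zero]
  have hQDc : Lᗮ.starProjection (D c : V) = D c := (starProjection_eq_self_iff).2 hDc
  have hPβ : L.orthogonalProjectionOnto β = -c := by
    rw [hβ', map_sub, map_sub, hPw, hPc, hPDc]; abel
  have hQβ : Lᗮ.starProjection β = w - (D c : V) := by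
    rw [hβ', map_sub, map_sub, hQw, hQc, hQDc]; abel
  rw [hPβ, hQβ, map_neg]
  simp

/-- The tangential part of the vertical vector: `P_T w = c + D c` with `c = -P_L β`.
[cite: White2005, §8.4 p. 1505 (12)] -/
theorem proj_tangent_eq (L : Submodule ℝ V) [L.HasOrthogonalProjection] (D : L →ₗ[ℝ] Lᗮ)
    [(LinearMap.range (L.subtype + Lᗮ.subtype ∘ₗ D)).HasOrthogonalProjection]
    {w : V} (hw : w ∈ Lᗮ) :
    (LinearMap.range (L.subtype + Lᗮ.subtype ∘ₗ D)).starProjection w =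
      -(L.orthogonalProjectionOnto
          (w - (LinearMap.range (L.subtype + Lᗮ.subtype ∘ₗ D)).starProjection w) : V) +
      (D (-(L.orthogonalProjectionOnto
          (w - (LinearMap.range (L.subtype + Lᗮ.subtype ∘ₗ D)).starProjection w))) : V) := by
  set T := LinearMap.range (L.subtype + Lᗮ.subtype ∘ₗ D) with hT
  obtain ⟨c, hc⟩ : ∃ c : L, (c : V) + (D c : V) = T.starProjection w :=
    LinearMap.mem_range.1 (starProjection_apply_mem T w)
  set β := w - T.starProjection w with hβ
  have hβ' : β = w - (c : V) - (D c : V) := by rw [hβ, ← hc]; abel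
  have hcL : (c : V) ∈ L := c.2
  have hDc : (D c : V) ∈ Lᗮ := (D c).2
  have hPw : L.orthogonalProjectionOnto w = 0 := (orthogonalProjectionOnto_eq_zero_iff).2 hw
  have hPc : L.orthogonalProjectionOnto (c : V) = c :=
    orthogonalProjectionOnto_mem_subspace_eq_self c
  have hPDc : L.orthogonalProjectionOnto (D c : V) = 0 :=
    (orthogonalProjectionOnto_eq_zero_iff).2 hDc
  have hPβ : L.orthogonalProjectionOnto β = -c := by
    rw [hβ', map_sub, map_sub, hPw, hPc, hPDc]; abel
  rw [hPβ, neg_neg, ← hc]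
  simp

end Literature.Geometry.Riemannian
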